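import Summits.BirchSwinnertonDyer.BirchSwinnertonDyer.Theorems.SignedLowerHalvesSmallImageLowerHalfBothSignsRttCharRoadE1LocalSquare
import Summits.BirchSwinnertonDyer.Rank1Residual.Additive.BaseChangeSubgroupH1
import Literature.NumberTheory.EllipticCurves.AnticyclotomicSignedSelmer
import HarnessLib

/-!
# Route `SignedLowerHalves`, crux L `SmallImageLowerHalfBothSigns` (stmt-BirchSwinnertonDyer-23599), line `rtt_w3` v11 — brick D3-W, bookkeeping for
# the glue (memo `Lines/rtt_w3-MEMO-D3c-w3g17.md` §8 step (2)): the `K`-side group of cell bsd-potss's base change, `comapResGal K (κ.layerSubgroup n ⊓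
# galRange K) = res⁻¹(Γ_{k_n} ∩ galRange K)`, IS the layer subgroup `Γ_{K_n}` of the restricted `ℤ_p`-extension `κ_K = κ.restrictOfFinrankEqTwo`,
# and Kobayashi's Kummer condition moves between the two (equal) groups by restriction.

Width seat `bsd-line-slh-p3-w3` g17 under LEAD `cruxlead-stmt-BirchSwinnertonDyer-23599` (cell `bsd-ssimc`; `--supports stmt-BirchSwinnertonDyer-23599 --as helper`).
THEOREMS ONLY (no definition, no named fact, no instance, no `sorry`). BSD / crux L / INJ are NOT proved here.

* `comapResGal_layerSubgroup_inf_galRange` — `comapResGal K (κ.layerSubgroup n ⊓ galRange K) = κ_K.layerSubgroup n`.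
* `resOfLe_mem_localKummerOverOfEmb_comapResGal` — a class over `κ_K.layerSubgroup n` in the Kummer condition cut out by `A'` at `ι'` restricts
  (along the equality) to a class over `comapResGal K (κ.layerSubgroup n ⊓ galRange K)` in the same condition (`AcSigned.map_resOfLe_localKummerOverOfEmb_le`)
  — the input of `EtaLayer.subgroupH1Iso_mem_localKummerOverOfEmb_iff`.

References: [Washington1997] §13.1; [SerreGaloisCohomology1997] II §1.1; [Kobayashi2003] Def. 1.1.
-/

set_option autoImplicit false
set_option linter.dupNamespace false -- D-0017: single-problem summit, the namespace repeats the problem name by design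
noncomputable section

open scoped Classical

universe u

namespace Summit.BirchSwinnertonDyer.BirchSwinnertonDyer.Theorems.SmallImageCharSignedSelmer

open Literature.NumberTheory.EllipticCurves Literature.NumberTheory.GaloisRepresentations Field
  Summit.BirchSwinnertonDyer.Rank1Residual.Additive.BaseChange

section Layer

variable {k : Type u} [Field k] [NumberField k] {p : ℕ} [hp : Fact p.Prime] (hp2 : p ≠ 2) (κ : ZpExtension k p)
  (K : Type u) [Field K] [NumberField K] [Algebra k K] (hK2 : Module.finrank k K = 2)

/-- **`res⁻¹(Γ_{k_n} ∩ galRange K) = Γ_{K_n}`**: the `K`-side group of the base change is the `n`-th layer subgroup of `κ_K`. [cite: Washington1997, §13.1] -/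
theorem comapResGal_layerSubgroup_inf_galRange (n : ℕ) :
    comapResGal K (κ.layerSubgroup n ⊓ galRange (K := k) K) = (κ.restrictOfFinrankEqTwo hp2 K hK2).layerSubgroup n := by
  ext τ
  rw [mem_comapResGal_iff, Subgroup.mem_inf, layerSubgroup_restrictOfFinrankEqTwo, Subgroup.mem_comap]
  exact ⟨fun h ↦ h.1, fun h ↦ ⟨h, (mem_galRange_iff K _).2 ⟨τ, rfl⟩⟩⟩

variable {E' : Type u} [Field E'] [Algebra K E'] (ι' : AlgebraicClosure K →ₐ[K] AlgebraicClosure E') (W : WeierstrassCurve k)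

/-- **The `K`-side Kummer condition over `Γ_{K_n}` restricts to the one over `res⁻¹(Γ_{k_n} ∩ galRange K)`** (the same group): for a class `y`
over `κ_K.layerSubgroup n` in `localKummerOverOfEmb (W.baseChange K) p _ ι' A'`, its restriction along the equality lies in
`localKummerOverOfEmb (W.baseChange K) p (comapResGal K (κ.layerSubgroup n ⊓ galRange K)) ι' A'` — ready for `EtaLayer.subgroupH1Iso_mem_localKummerOverOfEmb_iff`.
[cite: Kobayashi2003, Def. 1.1] [cite: SerreGaloisCohomology1997, I §2.4] -/
theorem resOfLe_mem_localKummerOverOfEmb_comapResGal (n : ℕ) (A' : AddSubgroup (localPoints (W.baseChange K) E'))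
    {y : (W.baseChange K).subgroupH1 p ((κ.restrictOfFinrankEqTwo hp2 K hK2).layerSubgroup n)}
    (hy : y ∈ Kobayashi2003.localKummerOverOfEmb (W.baseChange K) p ((κ.restrictOfFinrankEqTwo hp2 K hK2).layerSubgroup n) ι' A') :
    (W.baseChange K).resOfLe p (le_of_eq (comapResGal_layerSubgroup_inf_galRange hp2 κ K hK2 n)) y ∈
      Kobayashi2003.localKummerOverOfEmb (W.baseChange K) p (comapResGal K (κ.layerSubgroup n ⊓ galRange (K := k) K)) ι' A' :=
  AcSigned.map_resOfLe_localKummerOverOfEmb_le (W.baseChange K) p ι' (le_of_eq (comapResGal_layerSubgroup_inf_galRange hp2 κ K hK2 n)) A'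
    (AddSubgroup.mem_map_of_mem _ hy)

end Layer

end Summit.BirchSwinnertonDyer.BirchSwinnertonDyer.Theorems.SmallImageCharSignedSelmer

end
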